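import Summits.QuantumFields.YangMills.Theorems.CurvatureBoostCovariance.Negative.Unbundled
import Summits.QuantumFields.YangMills.Theorems.LatticeGapOnTrajectory.Negative.ZeroCouplingGap

/-!
# `CurvatureBoostCovariance` — negative-side support II: the vacuum and the degree-3 germ `S♯` inhabit every hypothesis

Support file for crux `stmt-QuantumFields-9663`, extracted from `Cruxes/CurvatureBoostCovariance/Disproof.lean`
(§3–§4). Tree objects only.

* `hypotheses_vac`: for EVERY compact group `G` and EVERY lattice representation `r`, the zero scheme and the
  vacuum family `vac` satisfy `W1 ∧ EightFrameRP ∧ PlanarCone ∧ PlanarInvariant` — the crux's hypotheses are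
  jointly satisfiable (`W₁` carries no non-triviality); uses the landed `hasLatticeMassGap_of_zero_coupling`.
* `sharp` (`S♯` = vacuum + evaluation at `(e₁,e₁,e₁)` in degree 3) and `hypotheses_sharp`: every hypothesis of
  the crux reads `S₁` only on `⁰𝒮`, on time-ordered data or in degree 0, and a constant configuration of `≥ 2`
  points is coincident and never strictly time-ordered (`append_apply_const_eq_zero`), so `S♯` inherits every
  hypothesis — the witness of support file III.
-/

noncomputable section

open scoped SchwartzMap ComplexConjugate
open MeasureTheory Filter Topology Complex
open Literature.MathematicalPhysics.AQFT Literature.MathematicalPhysics.QuantumLattice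
open Literature.MathematicalPhysics.QuantumFieldTheory

namespace Summit.QuantumFields.YangMills.Theorems.CurvatureBoostCovariance.Negative

/-! ## §3 Non-vacuity: the vacuum family inhabits every hypothesis (every `G`, every `r`)

§3a (`β = 0` ⇒ the uniform lattice gap is automatic for EVERY `Δ`) is the LANDED theorem
`LatticeGapOnTrajectory.Negative.hasLatticeMassGap_of_zero_coupling` (p-landed support file of the sibling crux
`stmt-QuantumFields-10523`; first written by the HypercubicLimit / LatticeGapOnTrajectory disprovers) — imported,
not re-proved.  Moral: `HasLatticeMassGap` constrains a witness only through the coupling sequence `β_k` it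
shares with the tie. -/


/-! ### §3b The vacuum family -/

/-- The one-species VACUUM family `𝔖₀ = 1`, `𝔖ₙ = 0` (`n ≥ 1`). -/
def vac : SchwingerFamily (EuclideanSpace ℝ (Fin 4)) :=
  fun n => if n = 0 then LabelledSchwingerFamily.evalAt (0 : Fin n → (EuclideanSpace ℝ (Fin 4))) else 0

/-- `vac.toLabelled` is the tree's `LabelledSchwingerFamily.trivial Unit`. -/
theorem vac_toLabelled : vac.toLabelled = LabelledSchwingerFamily.trivial Unit (EuclideanSpace ℝ (Fin 4)) := rfl

/-- In degree `0` the vacuum family is evaluation (at any configuration). -/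
theorem vac_zero_apply (F : 𝓢((Fin 0 → (EuclideanSpace ℝ (Fin 4))), ℂ)) (x : Fin 0 → (EuclideanSpace ℝ (Fin 4))) : vac 0 F = F x := by
  show (if (0 : ℕ) = 0 then LabelledSchwingerFamily.evalAt (0 : Fin 0 → (EuclideanSpace ℝ (Fin 4))) else 0) F = F x
  rw [if_pos rfl, LabelledSchwingerFamily.evalAt_apply]
  exact congrArg F (Subsingleton.elim _ _)

/-- In degree `0` all configurations coincide. -/
theorem conj_mul_eq_fin0 (F G : 𝓢((Fin 0 → (EuclideanSpace ℝ (Fin 4))), ℂ)) (x y x' y' : Fin 0 → (EuclideanSpace ℝ (Fin 4))) :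
    conj (F x) * G y = conj (F x') * G y' := by
  rw [Subsingleton.elim x x', Subsingleton.elim y y']

/-- In positive degree the vacuum family vanishes. -/
theorem vac_of_ne_zero {n : ℕ} (hn : n ≠ 0) : vac n = 0 := by
  simp only [vac, if_neg hn]

/-- The vacuum family satisfies E0, E0', E2, E3, (EuclideanSpace ℝ (Fin 4)) (tree `OSAxiomsSchwinger.trivial`). -/
theorem osPackage_vac : OSPackage vac := by
  have h : OSAxiomsSchwinger (LabelledSchwingerFamily.trivial Unit (EuclideanSpace ℝ (Fin 4))) := OSAxiomsSchwinger.trivial Unit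
  exact ⟨h.normalized, h.hermitian, h.linearGrowth, h.reflectionPositive, h.symmetric, h.cluster⟩

/-- The vacuum family is translation invariant on `⁰𝒮`. -/
theorem translations_vac : Translations vac := fun n a F hF =>
  (OSAxiomsSchwinger.trivial (d := 4) Unit).invariant.1 n (fun _ => ()) a F hF

/-- The vacuum family is invariant on `⁰𝒮` under EVERY determinant-one isometry. -/
theorem apply_linActMulti_vac (R : (EuclideanSpace ℝ (Fin 4)) ≃ₗᵢ[ℝ] (EuclideanSpace ℝ (Fin 4)))
    (hR : LinearMap.det (R.toLinearEquiv : (EuclideanSpace ℝ (Fin 4)) →ₗ[ℝ] (EuclideanSpace ℝ (Fin 4))) = 1) (n : ℕ) (F : 𝓢((Fin n → (EuclideanSpace ℝ (Fin 4))), ℂ))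
    (hF : IsOffDiagonal F) : vac n (linActMulti R F) = vac n F :=
  (OSAxiomsSchwinger.trivial (d := 4) Unit).invariant.2 n (fun _ => ()) R hR F hF

/-- The vacuum family is invariant under the proper signed permutations. -/
theorem hypercubic_vac : Hypercubic vac := fun R hR _ n F hF => apply_linActMulti_vac R hR n F hF

/-- The vacuum family is planar-rotation invariant on `⁰𝒮` (the crux's conclusion). -/
theorem planarInvariant_vac : PlanarInvariant vac := fun R hR _ _ n F hF =>
  apply_linActMulti_vac R hR n F hF

/-- The vacuum family has every mass gap. -/
theorem hasMassGap_vac (Δ : ℝ) : vac.toLabelled.HasMassGap Δ :=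
  OSData.vacuum_hasMassGap (ι := Unit) (d := 4) Δ

/-- Pulling the vacuum family back by any frame gives the vacuum family. -/
theorem pullback_vac (R : (EuclideanSpace ℝ (Fin 4)) ≃ₗᵢ[ℝ] (EuclideanSpace ℝ (Fin 4))) : (fun n => (vac n).comp (linActMulti R)) = vac := by
  funext n
  rcases Nat.eq_zero_or_pos n with rfl | hn
  · ext F
    rw [ContinuousLinearMap.comp_apply, vac_zero_apply _ (0 : Fin 0 → (EuclideanSpace ℝ (Fin 4))),
      vac_zero_apply F (0 : Fin 0 → (EuclideanSpace ℝ (Fin 4))), linActMulti_apply]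
    exact congrArg F (Subsingleton.elim _ _)
  · rw [vac_of_ne_zero hn.ne', ContinuousLinearMap.zero_comp]

/-- The vacuum family is reflection positive in the eight planar frames. -/
theorem eightFrameRP_vac : EightFrameRP vac := by
  intro R a b _ _ _
  rw [pullback_vac R]
  exact osPackage_vac.2.2.2.1

/-- The vacuum family has the planar cone: `Φ` is the constant `conj F(∅) G(∅)` in degree `0 + 0`
and `0` otherwise. -/
theorem planarCone_vac : PlanarCone vac := by
  intro n m F G _ _
  by_cases hnm : n + m = 0
  · obtain ⟨rfl, rfl⟩ : n = 0 ∧ m = 0 := by omega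
    haveI hE : IsEmpty (Fin (0 + 0)) := (inferInstance : IsEmpty (Fin 0))
    refine ⟨fun _ => conj (F 0) * G 0, differentiableOn_const _, fun t b _ H hH => ?_,
      fun w _ HF HG hHF hHG => ?_⟩
    · rw [vac_zero_apply H 0, hH, osAdjoint_apply, translateMulti_apply]
      exact conj_mul_eq_fin0 F G _ _ _ _
    · have h1 : vac (0 + 0) HF = conj (F 0) * F 0 := by
        rw [vac_zero_apply HF 0, hHF, osAdjoint_apply]
        exact conj_mul_eq_fin0 F F _ _ _ _
      have h2 : vac (0 + 0) HG = conj (G 0) * G 0 := by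
        rw [vac_zero_apply HG 0, hHG, osAdjoint_apply]
        exact conj_mul_eq_fin0 G G _ _ _ _
      rw [h1, h2, norm_mul, norm_mul, norm_mul, Complex.norm_conj, Complex.norm_conj]
      exact le_of_eq (by ring)
  · refine ⟨fun _ => 0, differentiableOn_const _, fun t b _ H _ => ?_, fun w _ HF HG _ _ => ?_⟩
    · simp [vac_of_ne_zero hnm]
    · simp only [norm_zero, ne_eq, OfNat.ofNat_ne_zero, not_false_eq_true, zero_pow]
      positivity

section VacuumLattice

variable {G : Type} [Group G] [TopologicalSpace G] [IsTopologicalGroup G] [CompactSpace G]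
  [MeasurableSpace G] [BorelSpace G]

/-- The vacuum family is tied to every scheme with `c_k = 0` on the curvature (e.g. the zero
scheme), for every `G`, `r`. -/
theorem tie_vac (r : LatticeRep G) (sch : SpeciesScheme (YMSpecies G))
    (hc : ∀ k, sch.c r.curvature k = 0) : Tie r sch vac := by
  intro n hn f F _ _
  have h0 : ∀ k, ((latticeSchwinger r.ρ sch (fun s => s.F) k n (fun _ => r.curvature) f : ℝ) : ℂ)
      = 0 := fun k => by
    rw [latticeSchwinger_eq_zero_of_c_eq_zero r sch hc k hn, Complex.ofReal_zero]
  simp only [h0, vac_of_ne_zero hn]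
  exact tendsto_const_nhds

/-- **§3c. NON-VACUITY of the whole hypothesis set**: for EVERY compact group `G` and EVERY
lattice representation `r`, the zero scheme and the vacuum family satisfy `W₁`, the eight-frame
RP and the planar cone (and, of course, the conclusion).  The hypotheses of the crux are jointly
satisfiable; the crux is not vacuous and not junk-refutable (`W₁` carries no non-triviality). -/
theorem hypotheses_vac (r : LatticeRep G) :
    W1 r (SpeciesScheme.zero _) vac ∧ EightFrameRP vac ∧ PlanarCone vac ∧ PlanarInvariant vac :=
  ⟨⟨tie_vac r _ fun _ => rfl, osPackage_vac, translations_vac, hypercubic_vac,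
    ⟨1, one_pos, hasMassGap_vac 1, Theorems.LatticeGapOnTrajectory.Negative.hasLatticeMassGap_of_zero_coupling r _ (fun _ => rfl) 1⟩⟩,
    eightFrameRP_vac, planarCone_vac, planarInvariant_vac⟩

end VacuumLattice


/-! ## §4 The natural strengthening "invariance as equality of functionals on all of `𝓢`" is FALSE

Witness `S♯` = vacuum family + (degree 3) evaluation at the constant configuration `(e₁,e₁,e₁)`.
Every hypothesis of the crux reads `S₁` only on `⁰𝒮`, on time-ordered data, or in degree `0`
— and a constant configuration of `≥ 2` points is in the coincidence locus and is never strictly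
time-ordered — so `S♯` inherits every hypothesis from the vacuum (for every `G`, `r`, zero
scheme); but the half-turn `diag(-1,-1,1,1)` of the `(x₀,x₁)`-plane moves `(e₁,e₁,e₁)` to
`(-e₁,-e₁,-e₁)`.  Message to provers: state and prove invariance ON `⁰𝒮` only; nothing pins a
tied family at coincident points. -/

/-- `e₁ = (0,1,0,0)`. -/
def e1 : (EuclideanSpace ℝ (Fin 4)) := EuclideanSpace.single 1 (1 : ℝ)

/-- A time-ordered test function of degree `≥ 2` vanishes at every constant configuration
(equal times are not strictly increasing). -/
theorem apply_const_eq_zero_of_isTimeOrdered {n : ℕ} {F : 𝓢((Fin n → (EuclideanSpace ℝ (Fin 4))), ℂ)}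
    (hF : IsTimeOrdered F) (hn : 2 ≤ n) (p : (EuclideanSpace ℝ (Fin 4))) : F (fun _ => p) = 0 := by
  refine image_eq_zero_of_notMem_tsupport fun hmem => ?_
  have h := (hF hmem).2
  have h01 : (⟨0, by omega⟩ : Fin n) < ⟨1, by omega⟩ := Fin.mk_lt_mk.2 zero_lt_one
  exact lt_irrefl _ (h h01)

/-- … and so does its OS adjoint. -/
theorem osAdjoint_apply_const_eq_zero {n : ℕ} {F : 𝓢((Fin n → (EuclideanSpace ℝ (Fin 4))), ℂ)}
    (hF : IsTimeOrdered F) (hn : 2 ≤ n) (p : (EuclideanSpace ℝ (Fin 4))) : osAdjoint F (fun _ => p) = 0 := by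
  rw [osAdjoint_apply]
  show conj (F fun _ => timeReflection 4 p) = 0
  rw [apply_const_eq_zero_of_isTimeOrdered hF hn, map_zero]

/-- **Master vanishing lemma.** A tensor witness of `θF* ⊗ G_{(v)}` with `F, G` time-ordered of
total degree `≥ 3` vanishes at every constant configuration (one factor has degree `≥ 2`). -/
theorem append_apply_const_eq_zero {n m : ℕ} {F : 𝓢((Fin n → (EuclideanSpace ℝ (Fin 4))), ℂ)} {G : 𝓢((Fin m → (EuclideanSpace ℝ (Fin 4))), ℂ)}
    (hF : IsTimeOrdered F) (hG : IsTimeOrdered G) (h3 : 3 ≤ n + m) (v : (EuclideanSpace ℝ (Fin 4)))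
    {H : 𝓢((Fin (n + m) → (EuclideanSpace ℝ (Fin 4))), ℂ)} (hH : IsAppendTensorOf H (osAdjoint F) (translateMulti v G))
    (p : (EuclideanSpace ℝ (Fin 4))) : H (fun _ => p) = 0 := by
  rw [hH]
  rcases le_or_gt 2 n with hn | hn
  · have h0 : osAdjoint F ((fun _ : Fin (n + m) => p) ∘ Fin.castAdd m) = 0 :=
      osAdjoint_apply_const_eq_zero hF hn p
    rw [h0, zero_mul]
  · have hm : 2 ≤ m := by omega
    have h0 : translateMulti v G ((fun _ : Fin (n + m) => p) ∘ Fin.natAdd n) = 0 := by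
      rw [translateMulti_apply]
      exact apply_const_eq_zero_of_isTimeOrdered hG hm (p - v)
    rw [h0, mul_zero]

/-- The same without translation (`θF* ⊗ G`, as in E2). -/
theorem append_apply_const_eq_zero' {n m : ℕ} {F : 𝓢((Fin n → (EuclideanSpace ℝ (Fin 4))), ℂ)} {G : 𝓢((Fin m → (EuclideanSpace ℝ (Fin 4))), ℂ)}
    (hF : IsTimeOrdered F) (hG : IsTimeOrdered G) (h3 : 3 ≤ n + m)
    {H : 𝓢((Fin (n + m) → (EuclideanSpace ℝ (Fin 4))), ℂ)} (hH : IsAppendTensorOf H (osAdjoint F) G)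
    (p : (EuclideanSpace ℝ (Fin 4))) : H (fun _ => p) = 0 := by
  rw [hH]
  rcases le_or_gt 2 n with hn | hn
  · have h0 : osAdjoint F ((fun _ : Fin (n + m) => p) ∘ Fin.castAdd m) = 0 :=
      osAdjoint_apply_const_eq_zero hF hn p
    rw [h0, zero_mul]
  · have hm : 2 ≤ m := by omega
    have h0 : G ((fun _ : Fin (n + m) => p) ∘ Fin.natAdd n) = 0 :=
      apply_const_eq_zero_of_isTimeOrdered hG hm p
    rw [h0, mul_zero]

/-- **The witness `S♯`**: the vacuum family plus, in degree `3`, evaluation at `(e₁,e₁,e₁)`. -/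
def sharp : SchwingerFamily (EuclideanSpace ℝ (Fin 4)) :=
  fun n => if n = 3 then LabelledSchwingerFamily.evalAt (fun _ : Fin n => e1) else vac n

/-- Off degree `3`, `S♯` is the vacuum family. -/
theorem sharp_of_ne {n : ℕ} (hn : n ≠ 3) : sharp n = vac n := if_neg hn

/-- In degree `3`, `S♯` is evaluation at `(e₁,e₁,e₁)`. -/
theorem sharp_three_apply (F : 𝓢((Fin 3 → (EuclideanSpace ℝ (Fin 4))), ℂ)) : sharp 3 F = F (fun _ => e1) := rfl

/-- `S♯` agrees with the vacuum on every test function vanishing at `(e₁,e₁,e₁)` (degree 3). -/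
theorem sharp_apply_eq_vac {n : ℕ} (F : 𝓢((Fin n → (EuclideanSpace ℝ (Fin 4))), ℂ)) (h : n = 3 → F (fun _ => e1) = 0) :
    sharp n F = vac n F := by
  by_cases hn : n = 3
  · subst hn
    rw [sharp_three_apply, h rfl, vac_of_ne_zero (by norm_num)]
    rfl
  · rw [sharp_of_ne hn]

/-- A constant configuration of `3` points is coincident. -/
theorem const_mem_coincidenceLocus (p : (EuclideanSpace ℝ (Fin 4))) : (fun _ : Fin 3 => p) ∈ coincidenceLocus 3 (EuclideanSpace ℝ (Fin 4)) :=
  ⟨0, 1, by decide, rfl⟩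

/-- `S♯ = vacuum` on `⁰𝒮`. -/
theorem sharp_apply_offDiagonal {n : ℕ} (F : 𝓢((Fin n → (EuclideanSpace ℝ (Fin 4))), ℂ)) (hF : IsOffDiagonal F) :
    sharp n F = vac n F :=
  sharp_apply_eq_vac F fun h3 => by subst h3; exact hF.apply_eq_zero (const_mem_coincidenceLocus e1)

/-- E2 for any one-species family whose values on E2-data are the vacuum's. -/
theorem isReflectionPositive_of_eq_vac (T : SchwingerFamily (EuclideanSpace ℝ (Fin 4)))
    (hT : ∀ (n m : ℕ) (F : 𝓢((Fin n → (EuclideanSpace ℝ (Fin 4))), ℂ)) (G : 𝓢((Fin m → (EuclideanSpace ℝ (Fin 4))), ℂ)),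
      IsTimeOrdered F → IsTimeOrdered G → ∀ H : 𝓢((Fin (n + m) → (EuclideanSpace ℝ (Fin 4))), ℂ),
        IsAppendTensorOf H (osAdjoint F) G → T (n + m) H = vac (n + m) H) :
    T.toLabelled.IsReflectionPositive := by
  intro N deg lab F hF H hH
  have hsum : (∑ i, ∑ j, T.toLabelled (deg i + deg j) (Fin.append (lab i ∘ Fin.rev) (lab j)) (H i j))
      = ∑ i, ∑ j, vac.toLabelled (deg i + deg j) (Fin.append (lab i ∘ Fin.rev) (lab j)) (H i j) :=
    Finset.sum_congr rfl fun i _ => Finset.sum_congr rfl fun j _ =>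
      hT _ _ _ _ (hF i) (hF j) _ (hH i j)
  have hv := osPackage_vac.2.2.2.1 N deg lab F hF H hH
  dsimp only at hv ⊢
  rw [hsum]
  exact hv

/-- `S♯` on E2-data of every frame is the vacuum: total degree `3` never survives a constant
configuration, other degrees are the vacuum by definition. -/
theorem sharp_pullback_append_eq_vac (R : (EuclideanSpace ℝ (Fin 4)) ≃ₗᵢ[ℝ] (EuclideanSpace ℝ (Fin 4))) {n m : ℕ} {F : 𝓢((Fin n → (EuclideanSpace ℝ (Fin 4))), ℂ)}
    {G : 𝓢((Fin m → (EuclideanSpace ℝ (Fin 4))), ℂ)} (hF : IsTimeOrdered F) (hG : IsTimeOrdered G)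
    (H : 𝓢((Fin (n + m) → (EuclideanSpace ℝ (Fin 4))), ℂ)) (hH : IsAppendTensorOf H (osAdjoint F) G) :
    sharp (n + m) (linActMulti R H) = vac (n + m) H := by
  rw [sharp_apply_eq_vac (linActMulti R H) fun h3 => by
    rw [linActMulti_apply]
    exact append_apply_const_eq_zero' hF hG h3.ge hH (R.symm e1)]
  show (fun k => (vac k).comp (linActMulti R)) (n + m) H = vac (n + m) H
  rw [pullback_vac R]

/-- `S♯` is reflection positive in pull-back form in EVERY frame (all isometries `R`). -/
theorem isReflectionPositive_sharp_pullback (R : (EuclideanSpace ℝ (Fin 4)) ≃ₗᵢ[ℝ] (EuclideanSpace ℝ (Fin 4))) :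
    (SchwingerFamily.toLabelled (fun n => (sharp n).comp (linActMulti R))).IsReflectionPositive :=
  isReflectionPositive_of_eq_vac _ fun _ _ _ _ hF hG H hH =>
    sharp_pullback_append_eq_vac R hF hG H hH

/-- `S♯` is reflection positive in the eight planar frames. -/
theorem eightFrameRP_sharp : EightFrameRP sharp := fun R _ _ _ _ _ =>
  isReflectionPositive_sharp_pullback R

/-- `S♯` is reflection positive along `e₀`. -/
theorem isReflectionPositive_sharp : sharp.toLabelled.IsReflectionPositive :=
  isReflectionPositive_of_eq_vac _ fun _ _ _ _ hF hG H hH =>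
    sharp_apply_eq_vac H fun h3 => append_apply_const_eq_zero' hF hG h3.ge hH e1

/-- `S♯` satisfies E0, E0', E2, E3, (EuclideanSpace ℝ (Fin 4)). -/
theorem osPackage_sharp : OSPackage sharp := by
  obtain ⟨h0, hh, hg, -, hs, hc⟩ := osPackage_vac
  refine ⟨fun k F => ?_, fun n k F hF => ?_, fun T => ?_, isReflectionPositive_sharp,
    fun n k π F hF => ?_, fun n m k k' F G hF hG a ha0 ha H hH => ?_⟩
  · -- E0 normalisation: degree 0 is the vacuum
    exact h0 k F
  · -- E0 hermiticity on time-ordered data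
    have e1' : sharp n F = vac n F := sharp_apply_eq_vac F fun h3 => by
      subst h3; exact apply_const_eq_zero_of_isTimeOrdered hF (by norm_num) e1
    have e2' : sharp n (osAdjoint F) = vac n (osAdjoint F) := sharp_apply_eq_vac _ fun h3 => by
      subst h3; exact osAdjoint_apply_const_eq_zero hF (by norm_num) e1
    simp only [SchwingerFamily.toLabelled_apply] at hh ⊢
    rw [e1', e2']
    exact hh n k F hF
  · -- E0' on ⁰𝒮
    obtain ⟨s, α, β, hαβ⟩ := hg T
    refine ⟨s, α, β, fun n k hk F hF => ?_⟩
    simp only [SchwingerFamily.toLabelled_apply] at hαβ ⊢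
    rw [sharp_apply_offDiagonal F hF]
    exact hαβ n k hk F hF
  · -- E3 on ⁰𝒮
    simp only [SchwingerFamily.toLabelled_apply] at hs ⊢
    rw [sharp_apply_offDiagonal F hF, sharp_apply_eq_vac (permTest π F) fun h3 => by
      subst h3; rw [permTest_apply]; exact hF.apply_eq_zero (const_mem_coincidenceLocus e1)]
    exact hs n k π F hF
  · -- (EuclideanSpace ℝ (Fin 4))
    simp only [SchwingerFamily.toLabelled_apply] at hc ⊢
    have hfun : (fun t : ℝ => sharp (n + m) (H t) - sharp n (osAdjoint F) * sharp m G) =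
        fun t : ℝ => vac (n + m) (H t) - vac n (osAdjoint F) * vac m G := by
      funext t
      rw [sharp_apply_eq_vac (H t) fun h3 => append_apply_const_eq_zero hF hG h3.ge _ (hH t) e1,
        sharp_apply_eq_vac (osAdjoint F) fun h3 => by
          subst h3; exact osAdjoint_apply_const_eq_zero hF (by norm_num) e1,
        sharp_apply_eq_vac G fun h3 => by
          subst h3; exact apply_const_eq_zero_of_isTimeOrdered hG (by norm_num) e1]
    rw [hfun]
    exact hc n m k k' F G hF hG a ha0 ha H hH

/-- `S♯` is translation invariant on `⁰𝒮`. -/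
theorem translations_sharp : Translations sharp := by
  intro n a F hF
  rw [sharp_apply_offDiagonal F hF, sharp_apply_eq_vac (translateMulti a F) fun h3 => by
    subst h3; rw [translateMulti_apply]; exact hF.apply_eq_zero (const_mem_coincidenceLocus _)]
  exact translations_vac n a F hF

/-- `S♯` is invariant ON `⁰𝒮` under every determinant-one isometry (like the vacuum). -/
theorem apply_linActMulti_sharp (R : (EuclideanSpace ℝ (Fin 4)) ≃ₗᵢ[ℝ] (EuclideanSpace ℝ (Fin 4)))
    (hR : LinearMap.det (R.toLinearEquiv : (EuclideanSpace ℝ (Fin 4)) →ₗ[ℝ] (EuclideanSpace ℝ (Fin 4))) = 1) (n : ℕ) (F : 𝓢((Fin n → (EuclideanSpace ℝ (Fin 4))), ℂ))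
    (hF : IsOffDiagonal F) : sharp n (linActMulti R F) = sharp n F := by
  rw [sharp_apply_offDiagonal F hF, sharp_apply_eq_vac (linActMulti R F) fun h3 => by
    subst h3; rw [linActMulti_apply]; exact hF.apply_eq_zero (const_mem_coincidenceLocus _)]
  exact apply_linActMulti_vac R hR n F hF

/-- `S♯` is invariant under the proper signed permutations on `⁰𝒮`. -/
theorem hypercubic_sharp : Hypercubic sharp := fun R hR _ n F hF => apply_linActMulti_sharp R hR n F hF

/-- `S♯` satisfies the crux's conclusion (on `⁰𝒮`). -/
theorem planarInvariant_sharp : PlanarInvariant sharp := fun R hR _ _ n F hF =>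
  apply_linActMulti_sharp R hR n F hF

/-- `S♯` has every mass gap. -/
theorem hasMassGap_sharp (Δ : ℝ) : sharp.toLabelled.HasMassGap Δ := by
  intro n m k k' F G hF hG
  obtain ⟨C, hC⟩ := hasMassGap_vac Δ n m k k' F G hF hG
  refine ⟨C, fun t ht H hH => ?_⟩
  simp only [SchwingerFamily.toLabelled_apply] at hC ⊢
  rw [sharp_apply_eq_vac H fun h3 => append_apply_const_eq_zero hF hG h3.ge _ hH e1,
    sharp_apply_eq_vac (osAdjoint F) fun h3 => by
      subst h3; exact osAdjoint_apply_const_eq_zero hF (by norm_num) e1,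
    sharp_apply_eq_vac G fun h3 => by
      subst h3; exact apply_const_eq_zero_of_isTimeOrdered hG (by norm_num) e1]
  exact hC t ht H hH

/-- `S♯` has the planar cone. -/
theorem planarCone_sharp : PlanarCone sharp := by
  intro n m F G hF hG
  obtain ⟨Φ, hΦ, h2, h3⟩ := planarCone_vac n m F G hF hG
  refine ⟨Φ, hΦ, fun t b ht H hH => ?_, fun w hw HF HG hHF hHG => ?_⟩
  · rw [h2 t b ht H hH, sharp_apply_eq_vac H fun h3 => append_apply_const_eq_zero hF hG h3.ge _ hH e1]
  · rw [sharp_of_ne (by omega : n + n ≠ 3), sharp_of_ne (by omega : m + m ≠ 3)]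
    exact h3 w hw HF HG hHF hHG

section SharpLattice

variable {G : Type} [Group G] [TopologicalSpace G] [IsTopologicalGroup G] [CompactSpace G]
  [MeasurableSpace G] [BorelSpace G]

/-- `S♯` is tied to every scheme with `c_k = 0` on the curvature. -/
theorem tie_sharp (r : LatticeRep G) (sch : SpeciesScheme (YMSpecies G))
    (hc : ∀ k, sch.c r.curvature k = 0) : Tie r sch sharp := by
  intro n hn f F hF hF'
  rw [sharp_apply_offDiagonal F hF']
  exact tie_vac r sch hc n hn f F hF hF'

/-- **`S♯` satisfies EVERY hypothesis of the crux** (any `G`, any `r`, zero scheme) and the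
conclusion on `⁰𝒮`. -/
theorem hypotheses_sharp (r : LatticeRep G) :
    W1 r (SpeciesScheme.zero _) sharp ∧ EightFrameRP sharp ∧ PlanarCone sharp ∧
      PlanarInvariant sharp :=
  ⟨⟨tie_sharp r _ fun _ => rfl, osPackage_sharp, translations_sharp, hypercubic_sharp,
    ⟨1, one_pos, hasMassGap_sharp 1, Theorems.LatticeGapOnTrajectory.Negative.hasLatticeMassGap_of_zero_coupling r _ (fun _ => rfl) 1⟩⟩,
    eightFrameRP_sharp, planarCone_sharp, planarInvariant_sharp⟩

end SharpLattice


end Summit.QuantumFields.YangMills.Theorems.CurvatureBoostCovariance.Negative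

end
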